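import Mathlib
import Literature.Geometry.Symplectic.JHolomorphicMap

/-!
# Stub `stub_confineQ` of line `Sketch` for crux `TameOrBrodyR4` (stmt-SmoothPoincare4-7826, route SullivanDual)

`Q`-confinement of pencil members by the maximum principle. Setting: `ℝ⁴ = EuclideanSpace ℝ (Fin 4)`,
a real-linear coordinate `Q : ℝ⁴ →L[ℝ] ℂ` with `|Q x| ≤ ‖x‖`, and a family `J x : ℝ⁴ →L[ℝ] ℝ⁴`
which is standard in the `Q`-direction where `‖x‖ ≥ R`, in the sense `Q (J x v) = i Q v`. For an
entire `C^∞` flat-`J`-holomorphic `u : ℂ → ℝ⁴` (`du(ξ)(i ζ) = J (u ξ) (du(ξ) ζ)`) with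
`Q (u ξ) → b` at infinity and `|b| < 2R`, we prove `|Q (u ξ)| ≤ 2R` for every `ξ`.

How.
* `ConfineQ.differentiableAt_of_fderiv_mul_I`: a real-differentiable `q : ℂ → ℂ` whose real
  derivative at `ξ` commutes with multiplication by `i` is complex differentiable at `ξ`
  (`Literature.Geometry.Symplectic.exists_restrictScalars_eq_of_map_mul_I` and
  `differentiableAt_iff_restrictScalars`).
* Hence `q = Q ∘ u` is complex differentiable at every `ξ` with `2R < |q ξ|`: there
  `‖u ξ‖ ≥ |q ξ| > 2R ≥ R`, so `dq(ξ)(i ζ) = Q (J (u ξ) (du(ξ) ζ)) = i dq(ξ) ζ`.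
* `ConfineQ.norm_le_of_tendsto` (maximum modulus principle on a superlevel set, adapted from
  `helper_slabBound` of `SullivanDualWitnessChargeHelperSlabBound.lean`): for a continuous
  `q : ℂ → ℂ`, complex differentiable wherever `M < |q|`, with `q → b` at infinity and `|b| < M`, the
  open set `V = {M < |q|}` is bounded (`|q| < M` off a compact set), `q` is differentiable on `V` and
  continuous on its closure, and `|q| ≤ M` on `frontier V = closure V ∖ V`; so
  `Complex.norm_le_of_forall_mem_frontier_norm_le` gives `|q| ≤ M` on `V`, i.e. `V = ∅`.

Sources: classical — L. V. Ahlfors, *Complex Analysis* (3rd ed., McGraw-Hill, 1979), Ch. 4 §3.4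
(the maximum principle); M. Gromov, Invent. Math. 82 (1985), §2.4.A (pencils of `J`-planes standard
at infinity). No `J`-curve theory beyond the definition is used.
-/

-- the registered namespace `Summit.SmoothPoincare4.SmoothPoincare4.…` repeats a component
set_option linter.dupNamespace false

noncomputable section

open scoped ContDiff Topology
open Filter Set Metric Literature.Geometry.Symplectic

namespace Summit.SmoothPoincare4.SmoothPoincare4.Cruxes.TameOrBrodyR4.Sketch

local notation "E4" => EuclideanSpace ℝ (Fin 4)

namespace ConfineQ

/-- **Cauchy–Riemann at a point.** A real-differentiable `q : ℂ → ℂ` whose real derivative at `ξ`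
commutes with multiplication by `i` is complex differentiable at `ξ` (a real-linear `ℂ → ℂ`
commuting with `i` is complex linear). -/
theorem differentiableAt_of_fderiv_mul_I {q : ℂ → ℂ} {ξ : ℂ} (hq : DifferentiableAt ℝ q ξ)
    (h : ∀ ζ : ℂ, fderiv ℝ q ξ (Complex.I * ζ) = Complex.I * fderiv ℝ q ξ ζ) :
    DifferentiableAt ℂ q ξ := by
  rw [differentiableAt_iff_restrictScalars ℝ hq]
  exact exists_restrictScalars_eq_of_map_mul_I (fderiv ℝ q ξ) fun ζ => by
    rw [smul_eq_mul]; exact h ζ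

-- adapted from `helper_slabBound` (Summits/…/SullivanDualWitnessChargeHelperSlabBound.lean)
/-- **Maximum principle on a superlevel set.** Let `q : ℂ → ℂ` be continuous, complex
differentiable at every point where `M < ‖q‖`, and tend to `b` at infinity with `‖b‖ < M`. Then
`‖q ξ‖ ≤ M` for every `ξ`: the open set `V = {M < ‖q‖}` is bounded, `q` is differentiable on `V` and
continuous on its closure with `‖q‖ ≤ M` on `frontier V`, so the maximum modulus principle
(`Complex.norm_le_of_forall_mem_frontier_norm_le`) bounds `‖q‖` by `M` on `V`, i.e. `V = ∅`. -/
theorem norm_le_of_tendsto {q : ℂ → ℂ} {M : ℝ} {b : ℂ} (hq : Continuous q)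
    (hd : ∀ ξ : ℂ, M < ‖q ξ‖ → DifferentiableAt ℂ q ξ) (hb : ‖b‖ < M)
    (hlim : Tendsto q (cocompact ℂ) (𝓝 b)) : ∀ ξ : ℂ, ‖q ξ‖ ≤ M := by
  intro ξ₀
  refine le_of_not_gt fun hlt => ?_
  -- the superlevel set `V = {M < ‖q‖}`: open, contains `ξ₀`
  set V : Set ℂ := {ξ | M < ‖q ξ‖} with hV_def
  have hVopen : IsOpen V := isOpen_lt continuous_const hq.norm
  have hξ₀V : ξ₀ ∈ V := hlt
  -- `V` is bounded: `‖q‖ < M` off a compact set, by the limit at infinity and `‖b‖ < M`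
  have hVbdd : Bornology.IsBounded V := by
    have hev : ∀ᶠ ξ in cocompact ℂ, q ξ ∈ ball (0 : ℂ) M :=
      hlim.eventually (isOpen_ball.mem_nhds (mem_ball_zero_iff.2 hb))
    obtain ⟨K, hK, hKsub⟩ := mem_cocompact'.1 hev
    refine hK.isBounded.subset fun ξ hξ => hKsub ?_
    rw [mem_compl_iff, mem_setOf_eq, mem_ball_zero_iff]
    exact fun h => lt_asymm h hξ
  -- the maximum modulus principle on the bounded open `V`
  have hdc : DiffContOnCl ℂ q V :=
    ⟨fun ξ hξ => (hd ξ hξ).differentiableWithinAt, hq.continuousOn⟩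
  have hC : ∀ z ∈ frontier V, ‖q z‖ ≤ M := by
    intro z hz
    rw [hVopen.frontier_eq] at hz
    exact le_of_not_gt hz.2
  have hle : ‖q ξ₀‖ ≤ M :=
    Complex.norm_le_of_forall_mem_frontier_norm_le hVbdd hdc hC (subset_closure hξ₀V)
  exact lt_irrefl _ (hlt.trans_le hle)

end ConfineQ

/-- **`Q`-confinement of non-honest members by the maximum principle.** For an entire `C^∞`
flat-`J`-holomorphic `u : ℂ → ℝ⁴` with `Q ∘ J_x = i Q` where `‖x‖ ≥ R` (`|Q x| ≤ ‖x‖`, `0 < R`) and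
`Q (u ξ) → b` at infinity, `|b| < 2R`: `|Q (u ξ)| ≤ 2R` for all `ξ`. Indeed `Q ∘ u` is complex
differentiable wherever `|Q ∘ u| > 2R` (there `‖u‖ > 2R ≥ R`, so its real derivative
`Q ∘ du` commutes with `i` by `J`-holomorphicity and standardness), and the maximum modulus
principle on the bounded open set `{|Q ∘ u| > 2R}` (`ConfineQ.norm_le_of_tendsto`) empties it. -/
theorem stub_confineQ (J : E4 → E4 →L[ℝ] E4) (R : ℝ) (hR : 0 < R) (Q : E4 →L[ℝ] ℂ)
    (hQ : ∀ x : E4, ‖Q x‖ ≤ ‖x‖)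
    (hJQ : ∀ x : E4, R ≤ ‖x‖ → ∀ v, Q (J x v) = Complex.I * Q v)
    (u : ℂ → E4) (hu : ContDiff ℝ ∞ u) (huJ : IsJHolomorphicFlat J u) (b : ℂ) (hb : ‖b‖ < 2 * R)
    (h5 : Tendsto (fun ξ => Q (u ξ)) (cocompact ℂ) (𝓝 b)) :
    ∀ ξ : ℂ, ‖Q (u ξ)‖ ≤ 2 * R := by
  have hud : Differentiable ℝ u := hu.differentiable (by simp)
  have h2R : R ≤ 2 * R := by linarith
  -- `q = Q ∘ u` is continuous with real derivative `Q ∘ du`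
  have hqc : Continuous fun ξ => Q (u ξ) := Q.continuous.comp hud.continuous
  have hqd : ∀ ξ : ℂ, HasFDerivAt (fun ξ => Q (u ξ)) (Q.comp (fderiv ℝ u ξ)) ξ := fun ξ =>
    Q.hasFDerivAt.comp ξ (hud ξ).hasFDerivAt
  -- far out (`|Q ∘ u| > 2R ≥ R`) the real derivative commutes with `i`: `q` is holomorphic there
  have hhol : ∀ ξ : ℂ, 2 * R < ‖Q (u ξ)‖ → DifferentiableAt ℂ (fun ξ => Q (u ξ)) ξ := by
    intro ξ hξ
    have hx : R ≤ ‖u ξ‖ := h2R.trans (hξ.le.trans (hQ (u ξ)))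
    refine ConfineQ.differentiableAt_of_fderiv_mul_I (hqd ξ).differentiableAt fun ζ => ?_
    rw [(hqd ξ).fderiv, ContinuousLinearMap.comp_apply, ContinuousLinearMap.comp_apply, huJ ξ ζ,
      hJQ _ hx]
  exact ConfineQ.norm_le_of_tendsto hqc hhol hb h5

end Summit.SmoothPoincare4.SmoothPoincare4.Cruxes.TameOrBrodyR4.Sketch
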